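import Mathlib
import Summits.Ventures.PercRepro2.SPNormalFormK
import Summits.Ventures.PercRepro2.SPGood
import Summits.Ventures.PercRepro2.UniversalLe10Known0
import Summits.Ventures.PercRepro2.UniversalLe10Known1
import Summits.Ventures.PercRepro2.UniversalLe10Known2

/-! # (UH*) on every series–parallel network of free edges with at most 10 edges
(seat mine-b, cell pub-perc-repro2; MINE-B.md §26.7)

The normal form of a free-edge term with ≤ 10 edges is one of the `SP.enumUpTo 10` (`SP.mem_enumUpTo`); a
kernel computation over that list shows each is `SP.good` or the normal form of a known term with a
kernel-certified theorem (`SP.enum10_covered`); `SP.universal_le10` assembles the pieces. -/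

namespace Summit.Ventures.PercRepro2.V2Closure

open Summit.Ventures.PercRepro2.UHClosure

/-- **every non-Good free-edge normal form with ≤ 10 edges** -/
def SP.known10 : List SP := SP.known10_0 ++ SP.known10_1 ++ SP.known10_2 ++ SP.known10_3 ++ SP.known10_4 ++ SP.known10_5

/-- **every normal free-edge term with ≤ 10 edges is Good or a known term up to normal form** (kernel computation
over the enumeration) -/
theorem SP.enum10_covered : ∀ u ∈ SP.enumUpTo 10,
    SP.good u = true ∨ u.toNat ∈ SP.known10.map (fun T => T.nfK.toNat) := by
  decide +kernel
/-- **(UH*) on every known term** -/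
theorem SP.known10_universal : ∀ T ∈ SP.known10, Universal T.rLab T.bLab := by
  intro T hT
  simp only [SP.known10, List.mem_append] at hT
  rcases hT with (((((h0 | h1) | h2) | h3) | h4) | h5)
  · exact SP.known10_0_universal T h0
  · exact SP.known10_1_universal T h1
  · exact SP.known10_2_universal T h2
  · exact SP.known10_3_universal T h3
  · exact SP.known10_4_universal T h4
  · exact SP.known10_5_universal T h5

/-- **THEOREM: (UH*) holds on every series–parallel network of free edges with at most 10 edges, in every
bracketing and ordering** — the normal form is Good (`SP.universal_of_good`) or the normal form of a known
term (its kernel-certified theorem, transported by `SP.universal_nfK`). -/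
theorem SP.universal_le10 (s : SP) (hs : s.IsFree) (hn : s.nfree ≤ 10) : Universal s.rLab s.bLab := by
  apply SP.universal_of_enumUpTo 10 _ s hs hn
  intro u hu
  rcases SP.enum10_covered u hu with hg | hk
  · exact SP.universal_of_good u (SP.good_spec u hg)
  · obtain ⟨T, hT, hcode⟩ := List.mem_map.1 hk
    have hu : u = T.nfK := SP.toNat_injective hcode.symm
    subst hu
    exact SP.universal_nfK T (SP.known10_universal T hT)

end Summit.Ventures.PercRepro2.V2Closure
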